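import Literature.NumberTheory.Automorphic.CompactCoreLevelPoint
import Literature.NumberTheory.Automorphic.OrbitalIntegralCentralTransport
import Literature.NumberTheory.Automorphic.UnitaryGroupOfLocalCovolumeStable
import HarnessLib

/-!
# The `H`-side of the smooth transfer at a split place: a CANONICAL class orbital integral on `H`,
# read through an isomorphism `j : H ≃* M` and a class-function weight `ψ`:
`Φ(⟦γ_H⟧, (ψ · g) ∘ j) = ψ(j γ_H) · O_{j γ_H}(g ; (j_* ν_H) ∕ ρ)` for EVERY canonically normalised `ρ`
(Rogawski, *Automorphic representations of unitary groups in three variables* (1990), §4.3 (4.3.1)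
p. 43 «compatible measures on `H_{γ′}` and `G_γ`», §4.9 p. 54, Lemma 4.13.1 p. 69; Deitmar–Echterhoff
(2014), Thm. 1.5.3)

Topic `NumberTheory/Rogawski1990` (road «D-N6s», brick **B5-L «H-SIDE»** of the split-place smooth
transfer, cut F0P3a-p03 (g9) 2026-09-01 (L1)–(L4)); namespace `Literature.NumberTheory.Automorphic`
(the statement is GENERIC in the pair of topological groups). THEOREMS ONLY (no definition, no
instance, no named fact, no `sorry`).

THE STATEMENT (generic form of (L2)–(L4)). Let `H`, `M` be locally compact second countable Hausdorff
groups, `j : H ≃* M` bicontinuous, `ν_H` a two-sided Haar measure on `H` and `ν_M = j_* ν_H`, `m_H` an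
orbital measure family on `H` which is CANONICAL for `(P, ν_H)` (★ `OrbitalMeasureFamily.IsCanonical`:
at every `P`-class the member is `ν_H ∕ t` for THE inversion-invariant Haar measure `t` on the
centraliser with mass one on its compact core), `γ_H ∈ H` with `P (out ⟦γ_H⟧)`, `p_M := j γ_H`,
`ψ : M → ℂ` constant on the `M`-conjugacy class of `p_M`, and `g : M → ℂ`. Then for EVERY Haar,
inversion-invariant measure `ρ` on `C_M(p_M)` with `ρ(compactCore) = 1`:

  `classOrbitalIntegral m_H ((ψ · g) ∘ j) ⟦γ_H⟧ = ψ(p_M) · orbitalIntegral p_M g (quotientMeasure C_M(p_M) ρ _ ν_M)`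

(`classOrbitalIntegral_comp_mulEquiv_eq_mul_orbitalIntegral_of_isCanonical`). Chain: (L2) the class
orbital integral is the orbital integral at the POINT `γ_H` against `m_H.atPoint γ_H = ν_H ∕ t′`, `t′`
canonically normalised on `C_H(γ_H)` (★ `OrbitalMeasureFamily.orbitalIntegral_atPoint`, ★
`IsCanonical.atPoint_eq_quotientMeasure`); (L3) transport along `j` (★
`integral_descConj_quotientMeasure_eq_of_mulEquiv`): the transported torus measure `(j|_{C_H(γ_H)})_* t′`
is Haar, inversion-invariant, of compact-core mass one, hence EQUALS the given `ρ` (★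
`map_eq_of_apply_compactCore_eq_one'` — canonical normalisations correspond under any isomorphism);
(L4) the class function `ψ` comes out of the orbital integral (`orbitalIntegral_mul_of_forall_conj_eq`).
(L1) — «`Φ^st_H(γ_H, φᴴ) = Φ(⟦γ_H⟧, φᴴ)` at a `G`-regular `γ_H`» — is ★ B3 `LocalTransferSplitPlaceClasses`
§4 and is consumed by the assembly B5-A, not restated here.

THE CM READING (B5-A instantiates token for token): `H := H_v = (U(2) × U(1))(F_v)` at a split
`w ∣ v`, `M := ↥(standardLeviGL F′ c₀)` (`F′ = L_w`, `c₀ i := decide (2 ≤ i)`),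
`j := j̃ = (e₂ × e₁).trans eM` (★ `localSplitEquiv` × ★ B4′ `exists_continuousMulEquiv_prod_standardLeviGL_twoBlock`),
`g := CTφ′` (★ B1's constant-term lambda), `ψ m := C.toReal · χ(m) · ‖det K_m‖^{1/2}` (a class function
of `M`), so that `φᴴ := (ψ · CTφ′) ∘ j̃` and the display above is exactly
`classOrbitalIntegral mH φᴴ ⟦γH⟧ = ψ pM * orbitalIntegral pM CTφ′ (quotientMeasure (Subgroup.centralizer {pM}) ρ _ νM)`,
`pM := j̃ γH`, `νM := νH.map j̃`, for every canonically normalised `ρ` — the shape B5-R∕B5-A consume.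

## References

* J. D. Rogawski, *Automorphic Representations of Unitary Groups in Three Variables*, Ann. of Math.
  Stud. 123 (1990), §4.3 (4.3.1) p. 43, §4.9 p. 54, §4.13 Lemma 4.13.1 p. 69 [Rogawski1990].
* A. Deitmar, S. Echterhoff, *Principles of Harmonic Analysis*, 2nd ed. (2014), Thm. 1.5.3
  [DeitmarEchterhoff2014].
* R. P. Langlands, D. Shelstad, *On the definition of transfer factors*, Math. Ann. 278 (1987), §1.3
  (compatible measures) [LanglandsShelstad1987].
-/

noncomputable section

open MeasureTheory Measure Topology Set Filter Function
open Literature.MeasureTheory.Group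
open scoped ENNReal NNReal

namespace Literature.NumberTheory.Automorphic

/-! ### (L4) A class-function weight comes out of the orbital integral -/

section Weight

variable {G : Type*} [Group G] (γ : G) [MeasurableSpace (G ⧸ Subgroup.centralizer ({γ} : Set G))]
  (μ : Measure (G ⧸ Subgroup.centralizer ({γ} : Set G)))

/-- **(L4) `O_γ(ψ · g) = ψ(γ) · O_γ(g)`** for `ψ : G → ℂ` constant on the conjugacy class of `γ`
(`ψ(y γ y⁻¹) = ψ(γ)`): the orbital integrand of `ψ · g` is `ψ(γ)` times that of `g`.
[cite: Rogawski1990, §4.9 p. 54] -/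
theorem orbitalIntegral_mul_of_forall_conj_eq (ψ g : G → ℂ) (hψ : ∀ y : G, ψ (y * γ * y⁻¹) = ψ γ) :
    orbitalIntegral γ (fun x => ψ x * g x) μ = ψ γ * orbitalIntegral γ g μ := by
  rw [orbitalIntegral_eq_integral_descConj, orbitalIntegral_eq_integral_descConj, ← integral_const_mul]
  refine integral_congr_ae (Eventually.of_forall fun y => ?_)
  induction y using QuotientGroup.induction_on with
  | H x =>
    simp only [descConj_mk]
    rw [hψ]

end Weight

/-! ### (L2)–(L4) The canonical class orbital integral through an isomorphism -/

section HSide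

variable {H M : Type*} [Group H] [Group M] [TopologicalSpace H] [TopologicalSpace M]
  [IsTopologicalGroup H] [IsTopologicalGroup M] [LocallyCompactSpace H] [LocallyCompactSpace M]
  [SecondCountableTopology H] [SecondCountableTopology M] [T2Space H] [T2Space M]
  [MeasurableSpace H] [BorelSpace H] [MeasurableSpace M] [BorelSpace M]
  [∀ γ : H, MeasurableSpace (H ⧸ Subgroup.centralizer ({γ} : Set H))]
  [∀ γ : H, BorelSpace (H ⧸ Subgroup.centralizer ({γ} : Set H))]
  (j : H ≃* M) (hj : Continuous j) (hjs : Continuous j.symm)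
  {P : H → Prop} {νH : Measure H} [νH.IsHaarMeasure] [νH.IsMulRightInvariant]
  {mH : OrbitalMeasureFamily H}

include hj hjs

/-- **(L2)–(L3) A canonical class orbital integral on `H`, read on `M` through `j : H ≃* M`, against ANY
canonically normalised torus measure.** For `m_H` canonical for `(P, ν_H)`, `γ_H` with `P (out ⟦γ_H⟧)`,
`ν_M = j_* ν_H`, and every Haar inversion-invariant `ρ` on `C_M(j γ_H)` with `ρ(compactCore) = 1`:
`classOrbitalIntegral m_H (F ∘ j) ⟦γ_H⟧ = orbitalIntegral (j γ_H) F (ν_M ∕ ρ)` for every `F : M → ℂ`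
(the class integral is the point integral against `m_H.atPoint γ_H = ν_H ∕ t′` with `t′` canonical, ★
`IsCanonical.atPoint_eq_quotientMeasure` + ★ `orbitalIntegral_atPoint`; transport along `j`, ★
`integral_descConj_quotientMeasure_eq_of_mulEquiv`; `(j|)_* t′ = ρ` since BOTH are canonically
normalised, ★ `map_eq_of_apply_compactCore_eq_one'` — Rogawski's «compatible measures on `H_{γ′}` and
`G_γ`»). [cite: Rogawski1990, §4.3 (4.3.1) p. 43] [cite: DeitmarEchterhoff2014, Thm. 1.5.3] -/
theorem classOrbitalIntegral_comp_mulEquiv_eq_orbitalIntegral_of_isCanonical (hm : mH.IsCanonical P νH)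
    (γH : H) (hP : P (Quotient.out (ConjClasses.mk γH)))
    (νM : Measure M) [νM.IsHaarMeasure] [νM.IsMulRightInvariant] (hνM : νM = Measure.map j νH)
    [MeasurableSpace (M ⧸ Subgroup.centralizer ({j γH} : Set M))]
    [BorelSpace (M ⧸ Subgroup.centralizer ({j γH} : Set M))]
    (ρ : Measure ↥(Subgroup.centralizer ({j γH} : Set M))) [ρ.IsHaarMeasure] [ρ.IsInvInvariant]
    (hρ : ρ (compactCore ↥(Subgroup.centralizer ({j γH} : Set M))) = 1) (F : M → ℂ) :
    classOrbitalIntegral mH (F ∘ j) (ConjClasses.mk γH) =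
      orbitalIntegral (j γH) F (quotientMeasure (Subgroup.centralizer ({j γH} : Set M)) ρ
        (isClosed_coe_centralizer_singleton (j γH)) νM) := by
  -- (L2) the class integral is the point integral against the canonical `ν_H / t'`
  obtain ⟨t', ht', ht'i, ht'1, hat⟩ := hm.atPoint_eq_quotientMeasure γH hP
  haveI : SMulInvariantMeasure H (H ⧸ Subgroup.centralizer
      ({(Quotient.out (ConjClasses.mk γH) : H)} : Set H)) (mH (ConjClasses.mk γH)) :=
    (hm.isAdmissibleOn _ hP).2.1
  rw [← OrbitalMeasureFamily.orbitalIntegral_atPoint mH γH (F ∘ j), hat]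
  -- instances on the two centralisers
  haveI hCH : IsClosed ((Subgroup.centralizer ({γH} : Set H) : Subgroup H) : Set H) :=
    isClosed_coe_centralizer_singleton γH
  haveI hCM : IsClosed ((Subgroup.centralizer ({j γH} : Set M) : Subgroup M) : Set M) :=
    isClosed_coe_centralizer_singleton (j γH)
  haveI : BorelSpace ↥(Subgroup.centralizer ({γH} : Set H)) := Subtype.borelSpace _
  haveI : BorelSpace ↥(Subgroup.centralizer ({j γH} : Set M)) := Subtype.borelSpace _
  haveI : LocallyCompactSpace ↥(Subgroup.centralizer ({γH} : Set H)) :=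
    hCH.isClosedEmbedding_subtypeVal.locallyCompactSpace
  haveI : LocallyCompactSpace ↥(Subgroup.centralizer ({j γH} : Set M)) :=
    hCM.isClosedEmbedding_subtypeVal.locallyCompactSpace
  haveI : SecondCountableTopology ↥(Subgroup.centralizer ({γH} : Set H)) :=
    TopologicalSpace.Subtype.secondCountableTopology _
  haveI : SecondCountableTopology ↥(Subgroup.centralizer ({j γH} : Set M)) :=
    TopologicalSpace.Subtype.secondCountableTopology _
  -- (L3) the restriction `C_H(γ_H) ≃ₜ* C_M(j γ_H)` of `j`; the transported `t'` IS `ρ`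
  have hZZ : ∀ g, j g ∈ Subgroup.centralizer ({j γH} : Set M) ↔ g ∈ Subgroup.centralizer ({γH} : Set H) :=
    forall_apply_mem_centralizer_singleton_iff_of_eq j rfl
  let eH : ↥(Subgroup.centralizer ({γH} : Set H)) ≃ₜ ↥(Subgroup.centralizer ({j γH} : Set M)) :=
    subgroupCongrHomeomorph j _ _ hZZ hj hjs
  let eZ : ↥(Subgroup.centralizer ({γH} : Set H)) ≃ₜ* ↥(Subgroup.centralizer ({j γH} : Set M)) :=
    { toMulEquiv :=
        { toEquiv := eH.toEquiv
          map_mul' := fun a b => Subtype.ext (map_mul j (a : H) (b : H)) }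
      continuous_toFun := eH.continuous
      continuous_invFun := eH.symm.continuous }
  have heZ : (⇑eZ : _ → ↥(Subgroup.centralizer ({j γH} : Set M))) = ⇑eH := rfl
  have hρ' : ρ = Measure.map eH t' := by
    rw [← heZ]
    exact (map_eq_of_apply_compactCore_eq_one' eZ t' ρ ht'1 hρ).symm
  rw [orbitalIntegral_eq_integral_descConj, orbitalIntegral_eq_integral_descConj]
  exact (integral_descConj_quotientMeasure_eq_of_mulEquiv j hj hjs (Subgroup.centralizer ({γH} : Set H))
    (Subgroup.centralizer ({j γH} : Set M)) hZZ t' ρ νH νM hρ' hνM (γ := γH) rfl _ _ F).symm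

/-- **B5-L «H-SIDE» — (L2)–(L4) assembled.** In the setting of
`classOrbitalIntegral_comp_mulEquiv_eq_orbitalIntegral_of_isCanonical`, for a weight `ψ : M → ℂ`
constant on the `M`-conjugacy class of `p_M := j γ_H` and any `g : M → ℂ`:
**`classOrbitalIntegral m_H ((fun m => ψ m * g m) ∘ j) ⟦γ_H⟧ = ψ p_M * orbitalIntegral p_M g ((j_* ν_H) ∕ ρ)`**
for EVERY Haar inversion-invariant `ρ` on `C_M(p_M)` of compact-core mass one — the `H`-side of
Rogawski's split-place transfer `Φ^{st}_H(γ_H, φᴴ) = ψ(p_M) · Φ^M_{p_M}(f̄^P)` once `φᴴ := (ψ · CTφ′) ∘ j̃`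
(Lemma 4.13.1; the CM instantiation is spelled out in the module docstring).
[cite: Rogawski1990, §4.13 Lemma 4.13.1 p. 69] [cite: Rogawski1990, §4.3 (4.3.1) p. 43] -/
theorem classOrbitalIntegral_comp_mulEquiv_eq_mul_orbitalIntegral_of_isCanonical (hm : mH.IsCanonical P νH)
    (γH : H) (hP : P (Quotient.out (ConjClasses.mk γH)))
    (νM : Measure M) [νM.IsHaarMeasure] [νM.IsMulRightInvariant] (hνM : νM = Measure.map j νH)
    [MeasurableSpace (M ⧸ Subgroup.centralizer ({j γH} : Set M))]
    [BorelSpace (M ⧸ Subgroup.centralizer ({j γH} : Set M))]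
    (ρ : Measure ↥(Subgroup.centralizer ({j γH} : Set M))) [ρ.IsHaarMeasure] [ρ.IsInvInvariant]
    (hρ : ρ (compactCore ↥(Subgroup.centralizer ({j γH} : Set M))) = 1)
    (ψ : M → ℂ) (hψ : ∀ y : M, ψ (y * j γH * y⁻¹) = ψ (j γH)) (g : M → ℂ) :
    classOrbitalIntegral mH ((fun m => ψ m * g m) ∘ j) (ConjClasses.mk γH) =
      ψ (j γH) * orbitalIntegral (j γH) g (quotientMeasure (Subgroup.centralizer ({j γH} : Set M)) ρ
        (isClosed_coe_centralizer_singleton (j γH)) νM) := by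
  rw [classOrbitalIntegral_comp_mulEquiv_eq_orbitalIntegral_of_isCanonical j hj hjs hm γH hP νM hνM ρ hρ,
    orbitalIntegral_mul_of_forall_conj_eq _ _ ψ g hψ]

/-- The same with the point `p_M` and the test function `φᴴ` NAMED by hypotheses (`hp : j γ_H = p_M`,
`hφ : φᴴ = (ψ · g) ∘ j`) — the literal shape B5-A rewrites with.
[cite: Rogawski1990, §4.13 Lemma 4.13.1 p. 69] -/
theorem classOrbitalIntegral_eq_mul_orbitalIntegral_of_isCanonical_of_eq (hm : mH.IsCanonical P νH)
    (γH : H) (hP : P (Quotient.out (ConjClasses.mk γH)))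
    (νM : Measure M) [νM.IsHaarMeasure] [νM.IsMulRightInvariant] (hνM : νM = Measure.map j νH)
    {pM : M} (hp : j γH = pM)
    [MeasurableSpace (M ⧸ Subgroup.centralizer ({pM} : Set M))]
    [BorelSpace (M ⧸ Subgroup.centralizer ({pM} : Set M))]
    (ρ : Measure ↥(Subgroup.centralizer ({pM} : Set M))) [ρ.IsHaarMeasure] [ρ.IsInvInvariant]
    (hρ : ρ (compactCore ↥(Subgroup.centralizer ({pM} : Set M))) = 1)
    (ψ : M → ℂ) (hψ : ∀ y : M, ψ (y * pM * y⁻¹) = ψ pM) (g : M → ℂ) {φH : H → ℂ}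
    (hφ : φH = fun h => ψ (j h) * g (j h)) :
    classOrbitalIntegral mH φH (ConjClasses.mk γH) =
      ψ pM * orbitalIntegral pM g (quotientMeasure (Subgroup.centralizer ({pM} : Set M)) ρ
        (isClosed_coe_centralizer_singleton pM) νM) := by
  subst hp hφ
  exact classOrbitalIntegral_comp_mulEquiv_eq_mul_orbitalIntegral_of_isCanonical j hj hjs hm γH hP νM hνM ρ hρ
    ψ hψ g

end HSide

end Literature.NumberTheory.Automorphic
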